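import Summits.ResolutionOfSingularities.ResolutionOfSingularities.Theorems.ValuativeTorsorToLurelFfiniteFrobenius
import Mathlib.FieldTheory.IsAlgClosed.AlgebraicClosure
import Mathlib.FieldTheory.PurelyInseparable.Basic
import Mathlib.FieldTheory.Perfect
import Mathlib.Algebra.CharP.Reduced
import Mathlib.FieldTheory.IntermediateField.Adjoin.Basic
import HarnessLib

/-!
# Crux `DualSandwich` (stmt-ResolutionOfSingularities-17083), line `birth`:
# stub `stub_frobeniusTop` — the regular Frobenius top of an `α_p`-torsor datum over a perfect field

Route `ResolutionOfSingularities/FoliationDescent`, crux #4 `DualSandwich := FolLU → LogCanQuotLU →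
TorsorLUPerfect`. The composition (`Cruxes/DualSandwich/Lines/birth.lean`) first replaces the torsor
datum — `k` perfect of characteristic `p`, `O` a valuation ring of `K`, `A₀ ⊆ O` a finitely generated
`k`-subalgebra regular at the centre of `O`, `t ^ p ∈ A₀`, `K = Frac k[A₀, t]` — by a REGULAR TOP:
a finite purely inseparable `L ⊇ K`, the valuation ring `O'` of `L` above `O`, a finitely generated
`B ⊆ O'` with `Frac B = L`, regular at the centre of `O'`, and `R = k[A₀, t]` with `R ⊆ B`; the
descent stubs then bring a regular model back down to `K` keeping `R`.

Witness (Temkin 2013, §1.3 / Rem. 1.3.5 (i), the Frobenius trick, read UPWARDS): write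
`A₀ = k[a₁, …, a_m]`, pick `p`-th roots `sᵢ` of the `aᵢ` in an algebraic closure and put
`L := K(s₁, …, s_m)`, `B := k[s₁, …, s_m]`, `O' := ρ⁻¹ O` for the Frobenius `ρ : L → K`,
`ρ x = x ^ p` (the exponent of `L/K` is one). Because `k` is PERFECT, `x ↦ x ^ p` maps `B` ONTO
`A₀` (`map_frob_adjoin_eq`), so `B ≅ A₀` is regular at the centre
(`isRegularLocalRing_centre_map_iterateFrobenius`, Temkin's transport, in the tree), and
`t ∈ B` (`t ^ p ∈ A₀ = B ^ p` and Frobenius is injective), whence `k[A₀, t] ⊆ B` and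
`Frac B ⊇ K(s) = L`.

Main result: `stub_frobeniusTop` (registered signature of the line, verbatim).
-/

noncomputable section

set_option linter.dupNamespace false -- single-problem summit: doubled namespace component is forced

open IsLocalRing

namespace Summit.ResolutionOfSingularities.ResolutionOfSingularities.Theorems.DualSandwich.Birth

/-! ## Two small field-theoretic facts -/

/-- If `a ^ (expchar) ^ n ∈ K` for every `a ∈ L`, the exponent of the purely inseparable
extension `L/K` is at most `n`. [folklore] -/
theorem exponent_le_of_forall_pow_mem {K L : Type*} [Field K] [Field L] [Algebra K L]
    [IsPurelyInseparable.HasExponent K L] {n : ℕ}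
    (h : ∀ a : L, a ^ ringExpChar K ^ n ∈ (algebraMap K L).range) :
    IsPurelyInseparable.exponent K L ≤ n := by
  by_contra hlt
  obtain ⟨a, ha⟩ := IsPurelyInseparable.exponent_min (not_le.mp hlt)
  exact ha (h a)

/-- In characteristic `p`, the elements of `E` whose `p`-th power lies in `F` form an intermediate
field; hence if a set `s` of such elements generates `E' = F(s)`, every element of `F(s)` has its
`p`-th power in `F`. [folklore] -/
theorem pow_mem_range_of_mem_adjoin {F E : Type*} [Field F] [Field E] [Algebra F E] (p : ℕ)
    [Fact p.Prime] [CharP E p] {s : Set E}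
    (hs : ∀ x ∈ s, x ^ p ∈ (algebraMap F E).range) {x : E}
    (hx : x ∈ IntermediateField.adjoin F s) : x ^ p ∈ (algebraMap F E).range := by
  induction hx using IntermediateField.adjoin_induction with
  | mem x hx => exact hs x hx
  | algebraMap x => exact ⟨x ^ p, by rw [map_pow]⟩
  | add x y _ _ ihx ihy =>
    obtain ⟨a, ha⟩ := ihx
    obtain ⟨b, hb⟩ := ihy
    exact ⟨a + b, by rw [map_add, ha, hb, add_pow_char]⟩
  | inv x _ ihx =>
    obtain ⟨a, ha⟩ := ihx
    exact ⟨a⁻¹, by rw [map_inv₀, ha, inv_pow]⟩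
  | mul x y _ _ ihx ihy =>
    obtain ⟨a, ha⟩ := ihx
    obtain ⟨b, hb⟩ := ihy
    exact ⟨a * b, by rw [map_mul, ha, hb, mul_pow]⟩

/-! ## The stub -/

/-- **The regular Frobenius top of an `α_p`-torsor datum over a perfect field** (stub
`stub_frobeniusTop` of line `birth` of the crux `DualSandwich`): for `k` perfect of characteristic
`p`, `O` a valuation ring of `K`, `A₀ ⊆ O` finitely generated and regular at the centre of `O`,
`t ^ p ∈ A₀` and `K = Frac k[A₀, t]`, there are a finite purely inseparable field extension
`L ⊇ K`, a valuation ring `O'` of `L` with `O' ∩ K = O`, a finitely generated `k`-subalgebra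
`B ⊆ O'` of `L` with `Frac B = L`, regular at the centre of `O'`, and a finitely generated `R ⊆ K`
with `A₀ ⊆ R ∋ t` and `R ⊆ B`. Witness: `L = K(a₁^{1/p}, …, a_m^{1/p})` inside an algebraic
closure (`A₀ = k[a₁, …, a_m]`), `O' = Frob⁻¹ O`, `B = k[a₁^{1/p}, …, a_m^{1/p}]`, which Frobenius
maps onto `A₀` because `k` is perfect, and `R = k[A₀, t]`.
[cite: Temkin2013, §1.3 and Rem. 1.3.5 (i)] -/
theorem stub_frobeniusTop :
    ∀ p : ℕ, p.Prime → ∀ (k K : Type) [Field k] [CharP k p] [PerfectField k] [Field K]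
      [Algebra k K] (O : ValuationSubring K) (A₀ : Subalgebra k K)
      (h₀ : A₀.toSubring ≤ O.toSubring) (t : K), A₀.FG → t ^ p ∈ A₀ →
      IsFractionRing (Algebra.adjoin k (insert t (A₀ : Set K))) K →
      IsRegularLocalRing (Localization.AtPrime
        (Ideal.comap (Subring.inclusion h₀) (IsLocalRing.maximalIdeal O))) →
      ∃ (L : Type) (_ : Field L) (_ : Algebra k L) (_ : Algebra K L) (_ : IsScalarTower k K L)
        (_ : FiniteDimensional K L) (_ : IsPurelyInseparable K L) (O' : ValuationSubring L)
        (B : Subalgebra k L) (hB : B.toSubring ≤ O'.toSubring) (R : Subalgebra k K),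
        O'.comap (algebraMap K L) = O ∧ B.FG ∧ IsFractionRing B L ∧
        IsRegularLocalRing (Localization.AtPrime
          (Ideal.comap (Subring.inclusion hB) (IsLocalRing.maximalIdeal O'))) ∧
        A₀ ≤ R ∧ t ∈ R ∧ R.FG ∧ R.map (IsScalarTower.toAlgHom k K L) ≤ B := by
  intro p hp k K _ _ _ _ _ O A₀ h₀ t hfg htp hfrac hreg
  classical
  haveI : Fact p.Prime := ⟨hp⟩
  haveI : CharP K p := charP_of_injective_algebraMap (algebraMap k K).injective p
  -- generators of `A₀`
  obtain ⟨S, hS⟩ := hfg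
  -- an algebraic closure and `p`-th roots of everything in `K`
  let M : Type := AlgebraicClosure K
  have hroot : ∀ a : K, ∃ z : M, z ^ p = algebraMap K M a := fun a =>
    IsAlgClosed.exists_pow_nat_eq _ hp.pos
  choose r hr using hroot
  -- the top field `L = K(r a | a ∈ S)`
  let T : Set M := r '' (S : Set K)
  let L : IntermediateField K M := IntermediateField.adjoin K T
  haveI : CharP L p := charP_of_injective_algebraMap (algebraMap K L).injective p
  have hTL : T ⊆ (L : Set M) := IntermediateField.subset_adjoin K T
  -- every element of `L` has its `p`-th power in `K` (exponent one)
  have hpowM : ∀ x : M, x ∈ L → x ^ p ∈ (algebraMap K M).range := by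
    intro x hx
    refine pow_mem_range_of_mem_adjoin p (fun y hy => ?_) hx
    obtain ⟨a, -, rfl⟩ := hy
    exact ⟨a, (hr a).symm⟩
  have hpow : ∀ x : L, x ^ p ∈ (algebraMap K L).range := by
    intro x
    obtain ⟨a, ha⟩ := hpowM x x.2
    exact ⟨a, Subtype.ext (by simpa using ha)⟩
  haveI hpi : IsPurelyInseparable K L :=
    (isPurelyInseparable_iff_pow_mem K p).mpr fun x => ⟨1, by rw [pow_one]; exact hpow x⟩
  haveI : IsPurelyInseparable.HasExponent K L :=
    ⟨1, fun x => by rw [ringExpChar.eq K p, pow_one]; exact hpow x⟩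
  have h1 : IsPurelyInseparable.exponent K L ≤ 1 :=
    exponent_le_of_forall_pow_mem fun x => by rw [ringExpChar.eq K p, pow_one]; exact hpow x
  -- finite-dimensional
  haveI : Finite T := ((S : Set K).toFinite.image r).to_subtype
  haveI hfd : FiniteDimensional K L :=
    IntermediateField.finiteDimensional_adjoin fun x _ =>
      (Algebra.IsAlgebraic.isAlgebraic (R := K) x).isIntegral
  -- the Frobenius `ρ : L → K`, `algebraMap (ρ x) = x ^ p`
  let ρ : L →+* K := IsPurelyInseparable.iterateFrobenius K L p h1
  have hρ : ∀ x : L, algebraMap K L (ρ x) = x ^ p := fun x => by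
    rw [IsPurelyInseparable.algebraMap_iterateFrobenius K p h1 x, pow_one]
  have hρK : ∀ a : K, ρ (algebraMap K L a) = a ^ p := fun a => by
    rw [IsPurelyInseparable.iterateFrobenius_algebraMap L p h1 a, pow_one]
  -- the regular top `B = k[r a | a ∈ S]`
  let TL : Set L := ((↑) : L → M) ⁻¹' T
  let B : Subalgebra k L := Algebra.adjoin k TL
  let ι : K →ₐ[k] L := IsScalarTower.toAlgHom k K L
  -- (P) `A₀ ⊆ B ^ p`: every element of `A₀` is the `p`-th power of an element of `B`
  have hP : ∀ x ∈ A₀, ∃ y ∈ B, y ^ p = algebraMap K L x := by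
    intro x hx
    rw [← hS] at hx
    induction hx using Algebra.adjoin_induction with
    | mem x hx =>
      refine ⟨⟨r x, hTL ⟨x, hx, rfl⟩⟩, Algebra.subset_adjoin (show r x ∈ T from ⟨x, hx, rfl⟩), ?_⟩
      exact Subtype.ext (by simpa using hr x)
    | algebraMap c =>
      obtain ⟨d, rfl⟩ := surjective_frobenius k p c
      refine ⟨algebraMap k L d, B.algebraMap_mem d, ?_⟩
      rw [frobenius_def, map_pow, IsScalarTower.algebraMap_apply k K L, map_pow]
    | add x y _ _ ihx ihy =>
      obtain ⟨a, ha, hax⟩ := ihx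
      obtain ⟨b, hb, hby⟩ := ihy
      exact ⟨a + b, add_mem ha hb, by rw [add_pow_char, hax, hby, map_add]⟩
    | mul x y _ _ ihx ihy =>
      obtain ⟨a, ha, hax⟩ := ihx
      obtain ⟨b, hb, hby⟩ := ihy
      exact ⟨a * b, mul_mem ha hb, by rw [mul_pow, hax, hby, map_mul]⟩
  -- hence `A₀ ⊆ B` (inside `L`) and `t ∈ B`
  have hA₀B : ∀ x ∈ A₀, algebraMap K L x ∈ B := by
    intro x hx
    obtain ⟨y, hy, hyx⟩ := hP x hx
    exact hyx ▸ pow_mem hy p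
  have htB : algebraMap K L t ∈ B := by
    obtain ⟨y, hy, hyt⟩ := hP (t ^ p) htp
    rw [map_pow] at hyt
    have : y = algebraMap K L t := frobenius_inj L p hyt
    exact this ▸ hy
  -- `ρ(B) = A₀`
  have hBρ : ∀ y ∈ B, ρ y ∈ A₀ := by
    intro y hy
    induction hy using Algebra.adjoin_induction with
    | mem y hy =>
      obtain ⟨a, ha, hay⟩ := hy
      have : ρ y = a := by
        apply (algebraMap K L).injective
        rw [hρ]
        have e := hr a
        rw [hay] at e
        exact Subtype.ext (by simpa using e)
      rw [this, ← hS]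
      exact Algebra.subset_adjoin ha
    | algebraMap c =>
      rw [IsScalarTower.algebraMap_apply k K L, hρK, ← map_pow]
      exact A₀.algebraMap_mem _
    | add x y _ _ ihx ihy => rw [map_add]; exact add_mem ihx ihy
    | mul x y _ _ ihx ihy => rw [map_mul]; exact mul_mem ihx ihy
  have hmapρ : B.toSubring.map ρ = A₀.toSubring := by
    ext x
    simp only [Subring.mem_map, Subalgebra.mem_toSubring]
    constructor
    · rintro ⟨y, hy, rfl⟩
      exact hBρ y hy
    · intro hx
      obtain ⟨y, hy, hyx⟩ := hP x hx
      refine ⟨y, hy, (algebraMap K L).injective ?_⟩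
      rw [hρ, hyx]
  -- the valuation ring `O' = ρ⁻¹ O` of `L`
  let O' : ValuationSubring L := O.comap ρ
  have hO' : O'.comap (algebraMap K L) = O := by
    ext x
    rw [ValuationSubring.mem_comap, ValuationSubring.mem_comap, hρK]
    exact valuationSubring_pow_mem_iff O hp.ne_zero x
  have hB : B.toSubring ≤ O'.toSubring := fun y hy => h₀ (hBρ y hy)
  -- regularity at the centre, transported along Frobenius
  have hBreg : IsRegularLocalRing (Localization.AtPrime
      (Ideal.comap (Subring.inclusion hB) (maximalIdeal O'))) :=
    (isRegularLocalRing_centre_map_iterateFrobenius p h1 O B.toSubring hB A₀.toSubring hmapρ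
      h₀).mpr hreg
  -- `B` is finitely generated
  have hBfg : B.FG := by
    refine Subalgebra.fg_def.mpr ⟨TL, ?_, rfl⟩
    exact ((S : Set K).toFinite.image r).preimage Subtype.val_injective.injOn
  -- the relative datum `R = k[A₀, t]`
  let R : Subalgebra k K := Algebra.adjoin k (insert t (A₀ : Set K))
  have hA₀R : A₀ ≤ R := fun x hx => Algebra.subset_adjoin (Set.mem_insert_of_mem t hx)
  have htR : t ∈ R := Algebra.subset_adjoin (Set.mem_insert t _)
  have hRfg : R.FG := by
    refine ⟨insert t S, ?_⟩
    show Algebra.adjoin k (↑(insert t S) : Set K) = Algebra.adjoin k (insert t (A₀ : Set K))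
    rw [Finset.coe_insert, ← hS, Algebra.adjoin_insert_adjoin]
  have hRB : R.map ι ≤ B := by
    rw [Subalgebra.map_le]
    refine Algebra.adjoin_le ?_
    rintro x (rfl | hx)
    · exact htB
    · exact hA₀B x hx
  -- `Frac B = L`
  have hBfr : IsFractionRing B L := by
    -- the subfield of fractions of `B`, as an intermediate field over `k`
    let F : IntermediateField k L := IntermediateField.adjoin k TL
    have hKF : ∀ x : K, algebraMap K L x ∈ F := by
      intro x
      haveI := hfrac
      obtain ⟨a, b, -, hab⟩ := IsFractionRing.div_surjective (A := R) x
      rw [← hab, map_div₀]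
      refine div_mem ?_ ?_
      · exact IntermediateField.algebra_adjoin_le_adjoin k TL (hRB ⟨a, a.2, rfl⟩)
      · exact IntermediateField.algebra_adjoin_le_adjoin k TL (hRB ⟨b, b.2, rfl⟩)
    let F' : IntermediateField K L := F.toSubfield.toIntermediateField hKF
    have hTF' : TL ⊆ (F' : Set L) := fun x hx => IntermediateField.subset_adjoin k TL hx
    have htop : IntermediateField.adjoin K TL = ⊤ := by
      apply IntermediateField.lift_injective
      rw [IntermediateField.lift_adjoin, IntermediateField.lift_top,
        Set.image_preimage_eq_of_subset]
      rwa [Subtype.range_coe]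
    have hF'top : F' = ⊤ := top_le_iff.mp (htop ▸ IntermediateField.adjoin_le_iff.mpr hTF')
    have hF : ∀ z : L, z ∈ F := fun z => show z ∈ F' from hF'top ▸ IntermediateField.mem_top
    refine IsFractionRing.of_field B L fun z => ?_
    obtain ⟨a, ha, b, hb, hz⟩ := IntermediateField.mem_adjoin_iff_div.mp (hF z)
    exact ⟨⟨a, ha⟩, ⟨b, hb⟩, hz⟩
  exact ⟨L, inferInstance, inferInstance, inferInstance, inferInstance, hfd, hpi, O', B, hB, R,
    hO', hBfg, hBfr, hBreg, hA₀R, htR, hRfg, hRB⟩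

end Summit.ResolutionOfSingularities.ResolutionOfSingularities.Theorems.DualSandwich.Birth

end
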